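import Literature.Probability.RandomPlanarGeometry.StarHullOneStep
import Literature.Probability.RandomPlanarGeometry.SLEKappaRhoLoewnerRepr
import Literature.Probability.RandomPlanarGeometry.SLERestrictionAdapted
import Literature.Probability.RandomPlanarGeometry.BrownianBubbles
import HarnessLib

/-!
# `Φ'_{B−x}(0) = E_B′(x)`: the jets of a `*`-hull as limits of restriction derivatives of its real translates

Companion of `StarHullCanonical` / `StarHullOneStep` (canonical data `starDeriv`, `starJet2`,
`starJet3` of a `*`-hull) and `SLEKappaRhoLoewnerRepr` (real translates `B − x` of hulls,
`SLEKappaRho.translate`), after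

* G. F. Lawler, O. Schramm, W. Werner, *Conformal restriction: the chordal case*, J. Amer. Math.
  Soc. **16** (2003) 917–955, arXiv:math/0209343 (**[LSW]**), §5: `h_t = g_{A_t}` and its
  derivatives `h_t′(W_t)`, `h_t″(W_t)`, `h_t‴(W_t)` at the driving point enter (5.3) and
  Prop. 5.3 through `h_t′(W_t)^α` and the Schwarzian `Sh_t(W_t)`; in slid coordinates
  (`B = A_t − W_t`, `E_B` the reflected extension of `Φ_B`) `h_t′(x + W_t) = E_B′(x) = Φ′_{B−x}(0)`
  is the restriction derivative of the translated hull `B − x` ([LSW] §8.3 uses the same device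
  for `h_t′(O_t)`);
* G. F. Lawler, *Conformally Invariant Processes in the Plane* (2005), §4.6.1 (4.35)–(4.37).

We PROVE, for a `*`-hull `B` off the ball `B(0, 8ρ₀)` and real `x` with `|x| < 4ρ₀`:

* `translateRMap hB x` — the restriction map `z ↦ Φ_B(z + x) − E_B(x)` of `B − x`
  (`isRestrictionMap_translateRMap`), with `Φ′_{B−x}(0) = E_B′(x)`
  (`hasRestrictionDeriv_translateRMap`), hence **`starDeriv (B − x) = Re E_B′(x)`**
  (`starDeriv_translate`);
* consequently the canonical jets are limits of DIFFERENCE QUOTIENTS of the restriction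
  derivatives of the translates (`abs_starDeriv_translate_sub_taylor_le`, from the Taylor
  expansion `Loewner.norm_deriv_hullExt_sub_taylor_le` of `E_B′`):
  `(Φ′_{B−h}(0) − Φ′_B(0))/h → E_B″(0) = starJet2 B` (`tendsto_slope_starDeriv_translate`) and
  `(Φ′_{B−h}(0) − 2Φ′_B(0) + Φ′_{B+h}(0))/h² → E_B‴(0) = starJet3 B`
  (`tendsto_secondDiff_starDeriv_translate`), as `h → 0`, `h ≠ 0`.

This reduces the measurability (in the driving path) of the jets of the slid hulls — hence of
the Schwarzian mass `−Sh_t(W_t)/6 = starJet2²/(4 starDeriv²) − starJet3/(6 starDeriv)` of the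
compensator of [LSW] Prop. 5.3 — to that of restriction derivatives of (translated) slid hulls,
which the tree proves by outer dyadic approximation (`SLERestrictionDerivMeasurable`); we carry
this out for a parametrised family of continuous driving paths from `0` with measurable values
up to time `t` (the setting of `SLERestrictionDerivMeasurable` / `SLERestrictionAdapted`):

* `Loewner.measurable_indicator_starDeriv_translate_slidHull` — `ω ↦ Φ′_{B_t(ω) − h}(0)` is
  measurable on the event `{alive, |h| < dist(0, B_t)}` (outer dyadic hulls of the translated
  dense slid points);
* **`Loewner.measurable_indicator_starJet2_slidHull`, `Loewner.measurable_indicator_starJet3_slidHull`,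
  `Loewner.measurable_indicator_schwarzMass_slidHull`** — `ω ↦ E_{B_t}″(0)`, `E_{B_t}‴(0)` and
  `m(B_t) = −Sh_t(W_t)/6` (times the indicator of the alive event) are measurable, as pointwise
  limits of (second) difference quotients in `h = 1/(n+1)`.

## References

* [LSW] §5 (h_t, (5.3), Prop. 5.3); §8.3. [LawlerSchrammWerner2003Restriction]
* Lawler (2005), §4.6.1. [Lawler2005]
-/

noncomputable section

open Set Filter Metric Function Complex Bornology
open _root_.Topology
open UpperHalfPlane (upperHalfPlaneSet)
open scoped NNReal

namespace Literature.Probability.RandomPlanarGeometry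

open Loewner SLEKappaRho

section Translate

variable {B : Set ℂ} {ρ₀ : ℝ}
variable (hB : IsStarHull B) (hρ₀ : 0 < ρ₀) (hBρ : Disjoint (ball (0 : ℂ) (8 * ρ₀)) B)

include hBρ in
/-- Real points of `(−8ρ₀, 8ρ₀)` are off the hull. [folklore] -/
theorem ofReal_notMem_of_abs_lt {x : ℝ} (hx : |x| < 8 * ρ₀) : (x : ℂ) ∉ B := fun h ↦
  Set.disjoint_left.1 hBρ (by rw [mem_ball_zero_iff, norm_real, Real.norm_eq_abs]; exact hx) h

/-- **The restriction map of the translate `B − x`**: `z ↦ Φ_B(z + x) − E_B(x)` (translation into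
`ℍ ∖ B`, the canonical map `Φ_B`, translation back by the real boundary value `E_B(x)`).
[cite: LawlerSchrammWerner2003Restriction, §5 (h_t′ at real points) and §8.3] -/
def translateRMap (hB : IsStarHull B) (x : ℝ) :
    ConformalEquiv (upperHalfPlaneSet \ translate B x) upperHalfPlaneSet :=
  (((ConformalEquiv.addReal x (upperHalfPlaneSet \ B)).copy (upperHalfPlaneSet \ translate B x)
      (upperHalfPlaneSet \ B) (diff_translate_eq B x) rfl).trans (starRMap B hB)).trans
    (addRealUpperHalfPlane (-(starMap B x).re))

/-- `translateRMap hB x z = Φ_B(z + x) − Re E_B(x)`. [folklore] -/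
theorem translateRMap_apply (hB : IsStarHull B) (x : ℝ) (z : ℂ) :
    translateRMap hB x z = starRMap B hB (z + x) - ((starMap B x).re : ℂ) := by
  simp only [translateRMap, ConformalEquiv.trans_apply, ConformalEquiv.copy_apply,
    ConformalEquiv.addReal_apply, addRealUpperHalfPlane_apply]
  push_cast
  ring

include hB hBρ in
/-- `E_B(x)` is real for `|x| < 8ρ₀`. [folklore] -/
theorem starMap_ofReal_eq_re {x : ℝ} (hx : |x| < 8 * ρ₀) : starMap B x = ((starMap B x).re : ℂ) := by
  rw [starMap_eq hB]
  have him := hullExt_ofReal_im (Φ := starRMap B hB) hB.isBoundedHull (isRestrictionMap_starRMap hB)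
    (ofReal_notMem_of_abs_lt hBρ hx)
  exact Complex.ext (by simp) (by simp [him])

/-- Translation maps `ℍ ∖ (B − x)` into `ℍ ∖ B`. [folklore] -/
theorem add_mem_diff_of_mem {x : ℝ} {z : ℂ} (hz : z ∈ upperHalfPlaneSet \ translate B x) :
    z + x ∈ upperHalfPlaneSet \ B := by
  rw [diff_translate_eq] at hz
  exact hz

/-- `z ↦ z + x` tends to `𝓝[ℍ ∖ B] x` along `𝓝[ℍ ∖ (B − x)] 0`. [folklore] -/
theorem tendsto_add_nhdsWithin_diff_translate (x : ℝ) :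
    Tendsto (fun z : ℂ ↦ z + x) (𝓝[upperHalfPlaneSet \ translate B x] 0)
      (𝓝[upperHalfPlaneSet \ B] (x : ℂ)) := by
  refine tendsto_nhdsWithin_iff.2 ⟨?_, ?_⟩
  · have : Tendsto (fun z : ℂ ↦ z + x) (𝓝 0) (𝓝 ((0 : ℂ) + x)) :=
      (continuous_id.add continuous_const).tendsto 0
    rw [zero_add] at this
    exact this.mono_left nhdsWithin_le_nhds
  · filter_upwards [self_mem_nhdsWithin] with z hz
    exact add_mem_diff_of_mem hz

/-- `z ↦ z + x` tends to `∞` in `ℍ ∖ B` along `∞` in `ℍ ∖ (B − x)`. [folklore] -/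
theorem tendsto_add_cocompact_diff_translate (x : ℝ) :
    Tendsto (fun z : ℂ ↦ z + x) (cocompact ℂ ⊓ 𝓟 (upperHalfPlaneSet \ translate B x))
      (cocompact ℂ ⊓ 𝓟 (upperHalfPlaneSet \ B)) := by
  refine tendsto_inf.2 ⟨?_, tendsto_principal.2 ?_⟩
  · have h : Tendsto (fun z : ℂ ↦ z + x) (cocompact ℂ) (cocompact ℂ) := by
      rw [← cobounded_eq_cocompact]
      exact tendsto_add_const_cobounded _
    exact h.mono_left inf_le_left
  · filter_upwards [mem_inf_of_right (mem_principal_self _)] with z hz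
    exact add_mem_diff_of_mem hz

include hBρ in
/-- **`translateRMap` is a restriction map of `B − x`** (`|x| < 8ρ₀`): boundary value `0` at `0`
(the boundary value of `Φ_B` at `x` is `E_B(x)`, `tendsto_hullExt_ofReal`) and `Ψ(z)/z → 1` at
`∞`. [cite: LawlerSchrammWerner2003Restriction, §2 p. 8 (Φ_A) with §5] -/
theorem isRestrictionMap_translateRMap {x : ℝ} (hx : |x| < 8 * ρ₀) :
    IsRestrictionMap (translate B x) (translateRMap hB x) := by
  have hΦ := isRestrictionMap_starRMap hB
  have hxB := ofReal_notMem_of_abs_lt hBρ hx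
  have hreal := starMap_ofReal_eq_re hB hBρ hx
  refine ⟨?_, ?_⟩
  · -- boundary value `0` at `0`
    change Tendsto (fun z ↦ translateRMap hB x z) (𝓝[upperHalfPlaneSet \ translate B x] 0) (𝓝 0)
    simp_rw [translateRMap_apply]
    have h1 := (tendsto_hullExt_ofReal hB.isBoundedHull hΦ hxB).comp (tendsto_add_nhdsWithin_diff_translate x)
    rw [← starMap_eq hB, hreal] at h1
    have h2 := h1.sub_const (((starMap B x).re : ℂ))
    rw [sub_self] at h2
    exact h2
  · -- `Ψ(z)/z → 1` at `∞`
    simp_rw [translateRMap_apply]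
    set F := cocompact ℂ ⊓ 𝓟 (upperHalfPlaneSet \ translate B x) with hF
    have hT := tendsto_add_cocompact_diff_translate (B := B) x
    have h1 : Tendsto (fun z : ℂ ↦ starRMap B hB (z + x) / (z + x)) F (𝓝 1) := hΦ.2.comp hT
    have hinv : Tendsto (fun z : ℂ ↦ z⁻¹) (cocompact ℂ) (𝓝 0) := by
      rw [← cobounded_eq_cocompact]; exact tendsto_inv₀_cobounded
    have hinv' : Tendsto (fun z : ℂ ↦ z⁻¹) F (𝓝 0) := hinv.mono_left inf_le_left
    have h2 : Tendsto (fun z : ℂ ↦ (z + x) / z) F (𝓝 1) := by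
      have : Tendsto (fun z : ℂ ↦ 1 + (x : ℂ) * z⁻¹) F (𝓝 (1 + (x : ℂ) * 0)) :=
        tendsto_const_nhds.add (hinv'.const_mul _)
      rw [mul_zero, add_zero] at this
      refine this.congr' ?_
      have hne : ∀ᶠ z : ℂ in F, z ≠ 0 := by
        filter_upwards [mem_inf_of_right (mem_principal_self _)] with z hz
        rintro rfl
        exact absurd hz.1 (by simp [upperHalfPlaneSet])
      filter_upwards [hne] with z hz
      field_simp
    have h3 : Tendsto (fun z : ℂ ↦ ((starMap B x).re : ℂ) * z⁻¹) F (𝓝 0) := by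
      simpa using hinv'.const_mul (((starMap B x).re : ℂ))
    have h4 := (h1.mul h2).sub h3
    rw [mul_one, sub_zero] at h4
    refine h4.congr' ?_
    have hne : ∀ᶠ z : ℂ in F, z ≠ 0 ∧ z + x ≠ 0 := by
      have hbig : ∀ᶠ z : ℂ in cocompact ℂ, |x| < ‖z‖ := by
        rw [← cobounded_eq_cocompact]
        exact (tendsto_norm_cobounded_atTop.eventually (eventually_gt_atTop |x|))
      filter_upwards [mem_inf_of_left hbig] with z hz
      constructor
      · rintro rfl; simp at hz; linarith [abs_nonneg x]
      · intro h
        have : z = -x := eq_neg_of_add_eq_zero_left h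
        rw [this, norm_neg, norm_real, Real.norm_eq_abs] at hz
        exact lt_irrefl _ hz
    filter_upwards [hne] with z hz
    obtain ⟨hz0, hzx⟩ := hz
    field_simp

include hρ₀ hBρ in
/-- **`Φ′_{B−x}(0) = E_B′(x)`**: the restriction derivative of the translate is the (real)
derivative of the reflected extension at `x` (`|x| < 4ρ₀`: `E_B` is holomorphic at `x`,
`Loewner.differentiableOn_starMap`, and real on the axis). [cite: LawlerSchrammWerner2003Restriction, §5 (h_t′(W_t) = Φ′_{A_t − W_t}(0))] -/
theorem hasRestrictionDeriv_translateRMap {x : ℝ} (hx : |x| < 4 * ρ₀) :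
    HasRestrictionDeriv (translate B x) (translateRMap hB x) (deriv (starMap B) x).re := by
  have hx8 : |x| < 8 * ρ₀ := by linarith
  have hΦ := isRestrictionMap_starRMap hB
  have hreal := starMap_ofReal_eq_re hB hBρ hx8
  -- `E_B` is differentiable at `x`
  have hxball : (x : ℂ) ∈ ball (0 : ℂ) (4 * ρ₀) := by
    rw [mem_ball_zero_iff, norm_real, Real.norm_eq_abs]; exact hx
  have hdiff : HasDerivAt (starMap B) (deriv (starMap B) x) x :=
    ((differentiableOn_starMap hB hρ₀ hBρ).differentiableAt (isOpen_ball.mem_nhds hxball)).hasDerivAt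
  -- reality of `E_B′(x)`
  obtain ⟨h1re, -, -⟩ := im_iteratedDeriv_hullExt_ofReal hB hΦ hρ₀ hBρ hx
  rw [← starMap_eq hB] at h1re
  have hdre : ((deriv (starMap B) x).re : ℂ) = deriv (starMap B) x := Complex.ext (by simp) (by simp [h1re])
  -- the slope of `E_B` at `x`, along `z ↦ z + x`
  have hslope : Tendsto (fun z : ℂ ↦ (starMap B (z + x) - starMap B x) / z) (𝓝[≠] 0)
      (𝓝 (deriv (starMap B) x)) := by
    have hs := hdiff.tendsto_slope
    have hT : Tendsto (fun z : ℂ ↦ z + x) (𝓝[≠] (0 : ℂ)) (𝓝[≠] (x : ℂ)) := by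
      refine tendsto_nhdsWithin_iff.2 ⟨?_, ?_⟩
      · have : Tendsto (fun z : ℂ ↦ z + x) (𝓝 0) (𝓝 ((0 : ℂ) + x)) :=
          (continuous_id.add continuous_const).tendsto 0
        rw [zero_add] at this
        exact this.mono_left nhdsWithin_le_nhds
      · filter_upwards [self_mem_nhdsWithin] with z hz
        simpa using hz
    have := hs.comp hT
    refine this.congr' (Eventually.of_forall fun z ↦ ?_)
    simp only [Function.comp_apply, slope_def_field, add_sub_cancel_right]
  unfold HasRestrictionDeriv
  rw [hdre]
  have hle : 𝓝[upperHalfPlaneSet \ translate B x] (0 : ℂ) ≤ 𝓝[≠] 0 :=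
    nhdsWithin_mono _ fun z hz h0 ↦ absurd hz.1 (by rw [h0]; simp [upperHalfPlaneSet])
  refine (hslope.mono_left hle).congr' ?_
  filter_upwards [self_mem_nhdsWithin] with z hz
  rw [translateRMap_apply, ← hreal, starMap_eq hB, hullExt_of_mem_diff (add_mem_diff_of_mem hz)]

include hB hρ₀ hBρ in
/-- **`starDeriv (B − x) = Re E_B′(x)`** for `|x| < 4ρ₀` (uniqueness of the restriction
derivative of the `*`-hull `B − x`). [cite: LawlerSchrammWerner2003Restriction, §5 (h_t′ at real points)] -/
theorem starDeriv_translate {x : ℝ} (hx : |x| < 4 * ρ₀) :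
    starDeriv (translate B x) = (deriv (starMap B) x).re := by
  have hx8 : |x| < 8 * ρ₀ := by linarith
  have hBx : IsStarHull (translate B x) := isStarHull_translate hB.isBoundedHull (ofReal_notMem_of_abs_lt hBρ hx8)
  exact (HasRestrictionDeriv.eq_starDeriv hBx (isRestrictionMap_translateRMap hB hBρ hx8)
    (hasRestrictionDeriv_translateRMap hB hρ₀ hBρ hx)).symm

/-! ### The jets as limits of difference quotients of `x ↦ Φ′_{B−x}(0)` -/

include hB hρ₀ hBρ in
/-- **Taylor expansion of `h ↦ Φ′_{B−h}(0)` at `0`**: for real `|h| ≤ ρ₀/4`,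
`|Φ′_{B−h}(0) − d − c₂ h − c₃ h²/2| ≤ (8/ρ₀³) |h|³` (`d = starDeriv B`, `c₂ = starJet2 B`,
`c₃ = starJet3 B`; real part of `Loewner.norm_deriv_hullExt_sub_taylor_le`). [folklore] -/
theorem abs_starDeriv_translate_sub_taylor_le {h : ℝ} (hh : |h| ≤ ρ₀ / 4) :
    |starDeriv (translate B h) - starDeriv B - starJet2 B * h - starJet3 B * h ^ 2 / 2| ≤
      8 / ρ₀ ^ 3 * |h| ^ 3 := by
  have hΦ := isRestrictionMap_starRMap hB
  have hd := (starDeriv_spec hB).2.2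
  have hz : ‖((h : ℝ) : ℂ)‖ ≤ ρ₀ / 4 := by rw [norm_real, Real.norm_eq_abs]; exact hh
  have hT := norm_deriv_hullExt_sub_taylor_le hB hΦ hd hρ₀ hBρ hz
  rw [← starMap_eq hB] at hT
  obtain ⟨e2, e3, -⟩ := starJet_spec hB hρ₀ hBρ
  rw [e2, e3, norm_real, Real.norm_eq_abs] at hT
  rw [starDeriv_translate hB hρ₀ hBρ (by linarith [abs_nonneg h])]
  have hre : (deriv (starMap B) h).re - starDeriv B - starJet2 B * h - starJet3 B * h ^ 2 / 2 =
      (deriv (starMap B) h - starDeriv B - (starJet2 B : ℂ) * h - (starJet3 B : ℂ) * (h : ℂ) ^ 2 / 2).re := by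
    simp only [sub_re, ofReal_re, mul_re, ofReal_im, zero_mul, sub_zero, div_ofNat_re]
    norm_cast
  rw [hre]
  exact (abs_re_le_norm _).trans hT

include hB hρ₀ hBρ in
/-- **`(Φ′_{B−h}(0) − Φ′_B(0))/h → E_B″(0) = starJet2 B`** as `h → 0`, `h ≠ 0`.
[cite: Lawler2005, §4.6.1 (h_t″(W_t))] -/
theorem tendsto_slope_starDeriv_translate :
    Tendsto (fun h : ℝ ↦ (starDeriv (translate B h) - starDeriv B) / h) (𝓝[≠] 0) (𝓝 (starJet2 B)) := by
  -- `|slope − c₂| ≤ |c₃| |h|/2 + (8/ρ₀³) h²` for small `h ≠ 0`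
  have hev : ∀ᶠ h : ℝ in 𝓝[≠] 0, |(starDeriv (translate B h) - starDeriv B) / h - starJet2 B| ≤
      8 / ρ₀ ^ 3 * |h| ^ 2 + |starJet3 B| / 2 * |h| := by
    have hsmall : ∀ᶠ h : ℝ in 𝓝[≠] (0 : ℝ), |h| ≤ ρ₀ / 4 := by
      have habs : Tendsto (fun h : ℝ ↦ |h|) (𝓝 0) (𝓝 0) := by
        simpa using (continuous_abs.tendsto (0 : ℝ))
      have h4 : ∀ᶠ h : ℝ in 𝓝 (0 : ℝ), |h| < ρ₀ / 4 := habs (Iio_mem_nhds (by positivity))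
      exact mem_nhdsWithin_of_mem_nhds (h4.mono fun h hh ↦ le_of_lt hh)
    filter_upwards [hsmall, self_mem_nhdsWithin] with h hh hne
    have hT := abs_starDeriv_translate_sub_taylor_le hB hρ₀ hBρ hh
    have hne' : h ≠ 0 := hne
    have heq : (starDeriv (translate B h) - starDeriv B) / h - starJet2 B =
        (starDeriv (translate B h) - starDeriv B - starJet2 B * h - starJet3 B * h ^ 2 / 2) / h +
          starJet3 B * h / 2 := by
      field_simp
      ring
    rw [heq]
    refine (abs_add_le _ _).trans (add_le_add ?_ ?_)
    · rw [abs_div]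
      rw [div_le_iff₀ (abs_pos.2 hne')]
      calc _ ≤ 8 / ρ₀ ^ 3 * |h| ^ 3 := hT
        _ = 8 / ρ₀ ^ 3 * |h| ^ 2 * |h| := by ring
    · rw [abs_div, abs_mul, abs_two]
      exact le_of_eq (by ring)
  have hlim : Tendsto (fun h : ℝ ↦ 8 / ρ₀ ^ 3 * |h| ^ 2 + |starJet3 B| / 2 * |h|) (𝓝[≠] 0) (𝓝 0) := by
    have : Tendsto (fun h : ℝ ↦ 8 / ρ₀ ^ 3 * |h| ^ 2 + |starJet3 B| / 2 * |h|) (𝓝 0)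
        (𝓝 (8 / ρ₀ ^ 3 * |(0 : ℝ)| ^ 2 + |starJet3 B| / 2 * |(0 : ℝ)|)) :=
      ((continuous_const.mul (continuous_abs.pow 2)).add (continuous_const.mul continuous_abs)).tendsto 0
    simp only [abs_zero, mul_zero, ne_eq, OfNat.ofNat_ne_zero, not_false_eq_true, zero_pow,
      zero_add] at this
    exact this.mono_left nhdsWithin_le_nhds
  rw [tendsto_iff_norm_sub_tendsto_zero]
  refine squeeze_zero' (Eventually.of_forall fun h ↦ norm_nonneg _) ?_ hlim
  filter_upwards [hev] with h hh
  rw [Real.norm_eq_abs]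
  exact hh

include hB hρ₀ hBρ in
/-- **`(Φ′_{B−h}(0) − 2Φ′_B(0) + Φ′_{B+h}(0))/h² → E_B‴(0) = starJet3 B`** as `h → 0`, `h ≠ 0`
(symmetric second differences). [cite: Lawler2005, §4.6.1 (h_t‴(W_t))] -/
theorem tendsto_secondDiff_starDeriv_translate :
    Tendsto (fun h : ℝ ↦ (starDeriv (translate B h) - 2 * starDeriv B + starDeriv (translate B (-h))) / h ^ 2)
      (𝓝[≠] 0) (𝓝 (starJet3 B)) := by
  have hev : ∀ᶠ h : ℝ in 𝓝[≠] 0,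
      |(starDeriv (translate B h) - 2 * starDeriv B + starDeriv (translate B (-h))) / h ^ 2 - starJet3 B| ≤
        16 / ρ₀ ^ 3 * |h| := by
    have hsmall : ∀ᶠ h : ℝ in 𝓝[≠] (0 : ℝ), |h| ≤ ρ₀ / 4 := by
      have habs : Tendsto (fun h : ℝ ↦ |h|) (𝓝 0) (𝓝 0) := by
        simpa using (continuous_abs.tendsto (0 : ℝ))
      have h4 : ∀ᶠ h : ℝ in 𝓝 (0 : ℝ), |h| < ρ₀ / 4 := habs (Iio_mem_nhds (by positivity))
      exact mem_nhdsWithin_of_mem_nhds (h4.mono fun h hh ↦ le_of_lt hh)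
    filter_upwards [hsmall, self_mem_nhdsWithin] with h hh hne
    have hne' : h ≠ 0 := hne
    have hT := abs_starDeriv_translate_sub_taylor_le hB hρ₀ hBρ hh
    have hT' := abs_starDeriv_translate_sub_taylor_le hB hρ₀ hBρ (h := -h) (by rwa [abs_neg])
    have heq : (starDeriv (translate B h) - 2 * starDeriv B + starDeriv (translate B (-h))) / h ^ 2 - starJet3 B =
        ((starDeriv (translate B h) - starDeriv B - starJet2 B * h - starJet3 B * h ^ 2 / 2) +
          (starDeriv (translate B (-h)) - starDeriv B - starJet2 B * (-h) - starJet3 B * (-h) ^ 2 / 2)) / h ^ 2 := by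
      field_simp
      ring
    rw [heq, abs_div, abs_pow, div_le_iff₀ (by positivity)]
    calc _ ≤ |starDeriv (translate B h) - starDeriv B - starJet2 B * h - starJet3 B * h ^ 2 / 2| +
          |starDeriv (translate B (-h)) - starDeriv B - starJet2 B * (-h) - starJet3 B * (-h) ^ 2 / 2| :=
          abs_add_le _ _
      _ ≤ 8 / ρ₀ ^ 3 * |h| ^ 3 + 8 / ρ₀ ^ 3 * |-h| ^ 3 := add_le_add hT hT'
      _ = 16 / ρ₀ ^ 3 * |h| * |h| ^ 2 := by rw [abs_neg]; ring
  have hlim : Tendsto (fun h : ℝ ↦ 16 / ρ₀ ^ 3 * |h|) (𝓝[≠] 0) (𝓝 0) := by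
    have : Tendsto (fun h : ℝ ↦ 16 / ρ₀ ^ 3 * |h|) (𝓝 0) (𝓝 (16 / ρ₀ ^ 3 * |(0 : ℝ)|)) :=
      (continuous_const.mul continuous_abs).tendsto 0
    simp only [abs_zero, mul_zero] at this
    exact this.mono_left nhdsWithin_le_nhds
  rw [tendsto_iff_norm_sub_tendsto_zero]
  refine squeeze_zero' (Eventually.of_forall fun h ↦ norm_nonneg _) ?_ hlim
  filter_upwards [hev] with h hh
  rw [Real.norm_eq_abs]
  exact hh

end Translate

/-! ### Measurability of the jets of the slid hulls in the driving path -/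

namespace Loewner

variable {Ω : Type*} {mΩ : MeasurableSpace Ω} {W : Ω → ℝ≥0 → ℝ} {A : Set ℂ} {t : ℝ≥0} {a : ℕ → ℂ}

open MeasureTheory

omit mΩ in
/-- The translated slid points are uniformly bounded along each path. [folklore] -/
theorem isBounded_range_slidPt_sub (hc : ∀ ω, Continuous (W ω)) (hA : IsBounded A)
    (ha : ∀ k, a k ∈ A ∧ 0 < (a k).im) (h : ℝ) (ω : Ω) :
    IsBounded (range fun k ↦ slidPt W a t k ω - h) := by
  obtain ⟨R, hR⟩ := (isBounded_range_slidPt (t := t) hc hA ha ω).subset_closedBall 0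
  refine (isBounded_closedBall (x := (0 : ℂ)) (r := R + ‖((h : ℝ) : ℂ)‖)).subset ?_
  rintro _ ⟨k, rfl⟩
  have hk : ‖slidPt W a t k ω‖ ≤ R := by simpa [mem_closedBall, dist_zero_right] using hR ⟨k, rfl⟩
  rw [mem_closedBall, dist_zero_right]
  exact (norm_sub_le _ _).trans (by linarith)

/-- The finite configuration of dyadic squares selected by the TRANSLATED slid points `b_k(ω) − h`.
[folklore] -/
def slidConfigT (hc : ∀ ω, Continuous (W ω)) (hA : IsBounded A) (ha : ∀ k, a k ∈ A ∧ 0 < (a k).im)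
    (t : ℝ≥0) (h : ℝ) (n : ℕ) (ω : Ω) : Finset (ℤ × ℤ) :=
  (finite_outerConfig (isBounded_range_slidPt_sub (t := t) hc hA ha h ω) n).toFinset

/-- The translated configuration as a set is `outerConfig` of the translated slid points. [folklore] -/
theorem coe_slidConfigT (hc : ∀ ω, Continuous (W ω)) (hA : IsBounded A) (ha : ∀ k, a k ∈ A ∧ 0 < (a k).im)
    (h : ℝ) (n : ℕ) (ω : Ω) :
    (slidConfigT hc hA ha t h n ω : Set (ℤ × ℤ)) = outerConfig (fun k ↦ slidPt W a t k ω - h) n :=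
  Finite.coe_toFinset _

/-- **The translated configuration map is measurable** into the countable set of finite
configurations (as `measurable_slidConfig`). [folklore] -/
theorem measurable_slidConfigT (hc : ∀ ω, Continuous (W ω)) (hA : IsBounded A) (ha : ∀ k, a k ∈ A ∧ 0 < (a k).im)
    (hmeas : ∀ s, s ≤ t → Measurable fun ω ↦ W ω s) (h : ℝ) (n : ℕ) :
    Measurable[mΩ, (⊤ : MeasurableSpace (Finset (ℤ × ℤ)))] (slidConfigT hc hA ha t h n) := by
  have hpm : ∀ k, Measurable fun ω ↦ slidPt W a t k ω - h := fun k ↦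
    (measurable_slidPt hc hmeas (fun k ↦ (ha k).2) k).sub_const _
  have hE : ∀ p : ℤ × ℤ, MeasurableSet {ω | p ∈ outerConfig (fun k ↦ slidPt W a t k ω - h) n} := by
    intro p
    have : {ω | p ∈ outerConfig (fun k ↦ slidPt W a t k ω - h) n} =
        ⋃ k, {ω | infDist (slidPt W a t k ω - h) (dyadicSquare n p.1 p.2) < 1 / 2 ^ n} := by
      ext ω; simp [outerConfig]
    rw [this]
    exact MeasurableSet.iUnion fun k ↦ measurableSet_lt
      ((continuous_infDist_pt (s := dyadicSquare n p.1 p.2)).measurable.comp (hpm k)) measurable_const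
  refine @measurable_to_countable' _ _ ⊤ _ _ _ fun F ↦ ?_
  have : slidConfigT hc hA ha t h n ⁻¹' {F} =
      ⋂ p : ℤ × ℤ, {ω | p ∈ outerConfig (fun k ↦ slidPt W a t k ω - h) n ↔ p ∈ F} := by
    ext ω
    simp only [mem_preimage, mem_singleton_iff, mem_iInter, mem_setOf_eq]
    rw [← Finset.coe_inj, coe_slidConfigT, Set.ext_iff]
    simp only [Finset.mem_coe]
  rw [this]
  refine MeasurableSet.iInter fun p ↦ ?_
  by_cases hp : p ∈ F
  · simp only [hp, iff_true]; exact hE p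
  · simp only [hp, iff_false]; exact (hE p).compl

/-- The event `{alive at t, |h| < dist(0, B_t)}` is measurable (`measurableSet_disjoint_closedHull`,
`measurable_slidDist`). [folklore] -/
theorem measurableSet_alive_and_lt_slidDist (hc : ∀ ω, Continuous (W ω)) (hW0 : ∀ ω, W ω 0 = 0)
    (hmeas : ∀ s, s ≤ t → Measurable fun ω ↦ W ω s) (hA : IsStarHull A) (hne : A.Nonempty) (h : ℝ) :
    MeasurableSet {ω | Disjoint (closedHull (W ω) t) A ∧ |h| < slidDist W A t ω} :=
  (measurableSet_disjoint_closedHull hc hW0 hmeas hA hne).inter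
    (measurableSet_lt measurable_const (measurable_slidDist hc hW0 hmeas hA hne))

omit mΩ in
/-- On `{alive, |h| < dist(0, B_t)}` the real point `h` is off the slid hull, so `B_t − h ∈ 𝒬*`.
[folklore] -/
theorem isStarHull_translate_slidHull {ω : Ω} (hW : Continuous (W ω)) (hA : IsStarHull A) {h : ℝ}
    (hω : Disjoint (closedHull (W ω) t) A ∧ |h| < slidDist W A t ω) :
    ((h : ℝ) : ℂ) ∉ slidHull (W ω) A t ∧ IsStarHull (translate (slidHull (W ω) A t) h) := by
  have hB := isStarHull_slidHull_of_disjoint hW hA hω.1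
  have hnot : ((h : ℝ) : ℂ) ∉ slidHull (W ω) A t := fun hmem ↦ by
    have h1 := infDist_le_dist_of_mem (x := (0 : ℂ)) hmem
    rw [← slidDist_of_disjoint hω.1, dist_comm, dist_zero_right, norm_real, Real.norm_eq_abs] at h1
    linarith [hω.2]
  exact ⟨hnot, isStarHull_translate hB.isBoundedHull hnot⟩

/-- **`ω ↦ Φ′_{B_t − h}(0)` is measurable on `{alive, |h| < dist(0, B_t)}`** (outer dyadic hulls
of the translated dense slid points, as `measurable_indicator_starDeriv_slidHull`).
[cite: LawlerSchrammWerner2003Restriction, §5 (h_t′ at real points)] -/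
theorem measurable_indicator_starDeriv_translate_slidHull (hc : ∀ ω, Continuous (W ω)) (hW0 : ∀ ω, W ω 0 = 0)
    (hmeas : ∀ s, s ≤ t → Measurable fun ω ↦ W ω s) (hA : IsStarHull A) (hne : A.Nonempty) (h : ℝ) :
    Measurable fun ω ↦ Set.indicator {ω | Disjoint (closedHull (W ω) t) A ∧ |h| < slidDist W A t ω}
      (fun ω ↦ starDeriv (translate (slidHull (W ω) A t) h)) ω := by
  classical
  obtain ⟨a, ha, hdense⟩ := exists_denseSeq hA hne
  have hAb : IsBounded A := hA.isBoundedHull.isCompact.isBounded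
  have hEm := measurableSet_alive_and_lt_slidDist hc hW0 hmeas hA hne h
  set G : ℕ → Ω → ℝ := fun n ω ↦ starDeriv (outerHull n (slidConfigT hc hAb ha t h n ω : Set (ℤ × ℤ))) with hG
  have hGm : ∀ n, Measurable (G n) := fun n ↦
    (@measurable_from_top _ _ _ (f := fun F : Finset (ℤ × ℤ) ↦ starDeriv (outerHull n (F : Set (ℤ × ℤ))))).comp
      (measurable_slidConfigT hc hAb ha hmeas h n)
  have hGm' : ∀ n, Measurable fun ω ↦ Set.indicator
      {ω | Disjoint (closedHull (W ω) t) A ∧ |h| < slidDist W A t ω} (G n) ω := fun n ↦ (hGm n).indicator hEm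
  refine measurable_of_tendsto_metrizable hGm' (tendsto_pi_nhds.2 fun ω ↦ ?_)
  by_cases hω : Disjoint (closedHull (W ω) t) A ∧ |h| < slidDist W A t ω
  · simp only [Set.indicator_of_mem (show ω ∈ {ω | Disjoint (closedHull (W ω) t) A ∧ |h| < slidDist W A t ω} from hω)]
    obtain ⟨-, hBh⟩ := isStarHull_translate_slidHull (hc ω) hA hω
    -- translated dense points
    have hb : ∀ k, slidPt W a t k ω - h ∈ translate (slidHull (W ω) A t) h := fun k ↦
      ⟨slidPt W a t k ω, slidPt_mem (fun k ↦ (ha k).1) k ω, rfl⟩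
    have hd : translate (slidHull (W ω) A t) h ⊆ closure (range fun k ↦ slidPt W a t k ω - h) := by
      rintro _ ⟨z, hz, rfl⟩
      have hzcl := slidHull_subset_closure_range_slidPt (hc ω) hA hdense hω.1 hz
      have hcont : Continuous fun w : ℂ ↦ w - h := continuous_id.sub continuous_const
      have := mem_closure_image hcont.continuousAt hzcl
      rwa [← range_comp] at this
    have hneT : (translate (slidHull (W ω) A t) h).Nonempty := (hne.image _).image _
    have := tendsto_starDeriv_outerHull hBh hneT hb hd
    simp only [hG, coe_slidConfigT]
    exact this
  · simp only [Set.indicator_of_notMem (show ω ∉ {ω | Disjoint (closedHull (W ω) t) A ∧ |h| < slidDist W A t ω} from hω)]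
    exact tendsto_const_nhds

/-- A `*`-hull is at positive distance from `0`, with a ball `B(0, 8ρ₀)` off it. [folklore] -/
theorem exists_rho_of_isStarHull {B : Set ℂ} (hB : IsStarHull B) :
    ∃ ρ₀ : ℝ, 0 < ρ₀ ∧ Disjoint (ball (0 : ℂ) (8 * ρ₀)) B := by
  obtain ⟨r, hr0, hr⟩ := hB.exists_disjoint_ball
  exact ⟨r / 4, by positivity, by rwa [show 8 * (r / 4) = 2 * r by ring]⟩

omit mΩ in
/-- On the alive event the distance `dist(0, B_t)` is positive. [folklore] -/
theorem slidDist_pos_of_disjoint {ω : Ω} (hW : Continuous (W ω)) (hA : IsStarHull A) (hne : A.Nonempty)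
    (hω : Disjoint (closedHull (W ω) t) A) : 0 < slidDist W A t ω := by
  have hB := isStarHull_slidHull_of_disjoint hW hA hω
  rw [slidDist_of_disjoint hω]
  have hcl : IsClosed (slidHull (W ω) A t) := hB.isBoundedHull.isClosed
  have hne' : (slidHull (W ω) A t).Nonempty := hne.image _
  rw [← hcl.notMem_iff_infDist_pos hne']
  exact hB.zero_notMem

/-- The sequence `1/(n+1)` tends to `0` within `{0}ᶜ`. [folklore] -/
theorem tendsto_one_div_add_one_nhdsWithin :
    Tendsto (fun n : ℕ ↦ (1 : ℝ) / ((n : ℝ) + 1)) atTop (𝓝[≠] 0) :=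
  tendsto_nhdsWithin_iff.2 ⟨tendsto_one_div_add_atTop_nhds_zero_nat,
    Eventually.of_forall fun n ↦ by
      have : (0 : ℝ) < 1 / ((n : ℝ) + 1) := by positivity
      exact this.ne'⟩

/-- **`ω ↦ E_{B_t}″(0) · 𝟙{alive}` is measurable**: `starJet2 (B_t)` is the limit of the difference
quotients `(Φ′_{B_t − h}(0) − Φ′_{B_t}(0))/h`, `h = 1/(n+1)` (`tendsto_slope_starDeriv_translate`),
each measurable on `{alive, h < dist(0, B_t)}`, an event eventually containing every alive `ω`.
[cite: LawlerSchrammWerner2003Restriction, §5 (h_t″(W_t) in (5.3))] -/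
theorem measurable_indicator_starJet2_slidHull (hc : ∀ ω, Continuous (W ω)) (hW0 : ∀ ω, W ω 0 = 0)
    (hmeas : ∀ s, s ≤ t → Measurable fun ω ↦ W ω s) (hA : IsStarHull A) (hne : A.Nonempty) :
    Measurable fun ω ↦ Set.indicator {ω | Disjoint (closedHull (W ω) t) A}
      (fun ω ↦ starJet2 (slidHull (W ω) A t)) ω := by
  classical
  set hseq : ℕ → ℝ := fun n ↦ 1 / ((n : ℝ) + 1) with hhseq
  set E : ℕ → Set Ω := fun n ↦ {ω | Disjoint (closedHull (W ω) t) A ∧ |hseq n| < slidDist W A t ω} with hE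
  -- the measurable approximants
  set F : ℕ → Ω → ℝ := fun n ω ↦
    ((E n).indicator (fun ω ↦ starDeriv (translate (slidHull (W ω) A t) (hseq n))) ω -
      (E n).indicator (fun ω ↦ starDeriv (slidHull (W ω) A t)) ω) / hseq n with hF
  have hDm : Measurable fun ω ↦ Set.indicator {ω | Disjoint (closedHull (W ω) t) A}
      (fun ω ↦ starDeriv (slidHull (W ω) A t)) ω :=
    measurable_indicator_starDeriv_slidHull hc hW0 hmeas hA hne
  have hFm : ∀ n, Measurable (F n) := by
    intro n
    have h1 := measurable_indicator_starDeriv_translate_slidHull hc hW0 hmeas hA hne (hseq n)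
    have hEn : MeasurableSet (E n) := measurableSet_alive_and_lt_slidDist hc hW0 hmeas hA hne (hseq n)
    -- `𝟙_{E n} · starDeriv B_t = 𝟙_{E n} · (𝟙_{alive} · starDeriv B_t)`
    have h2 : Measurable fun ω ↦ (E n).indicator (fun ω ↦ starDeriv (slidHull (W ω) A t)) ω := by
      have : (fun ω ↦ (E n).indicator (fun ω ↦ starDeriv (slidHull (W ω) A t)) ω) =
          fun ω ↦ (E n).indicator (fun ω ↦ Set.indicator {ω | Disjoint (closedHull (W ω) t) A}
            (fun ω ↦ starDeriv (slidHull (W ω) A t)) ω) ω := by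
        funext ω
        by_cases hω : ω ∈ E n
        · rw [Set.indicator_of_mem hω, Set.indicator_of_mem hω,
            Set.indicator_of_mem (show ω ∈ {ω | Disjoint (closedHull (W ω) t) A} from hω.1)]
        · rw [Set.indicator_of_notMem hω, Set.indicator_of_notMem hω]
      rw [this]
      exact hDm.indicator hEn
    exact (h1.sub h2).div_const _
  refine measurable_of_tendsto_metrizable hFm (tendsto_pi_nhds.2 fun ω ↦ ?_)
  by_cases hω : Disjoint (closedHull (W ω) t) A
  · simp only [Set.indicator_of_mem (show ω ∈ {ω | Disjoint (closedHull (W ω) t) A} from hω)]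
    have hB := isStarHull_slidHull_of_disjoint (hc ω) hA hω
    obtain ⟨ρ₀, hρ₀, hBρ⟩ := exists_rho_of_isStarHull hB
    -- eventually `ω ∈ E n`
    have hpos := slidDist_pos_of_disjoint (hc ω) hA hne hω
    have hev : ∀ᶠ n in atTop, ω ∈ E n := by
      have h1 : ∀ᶠ n in atTop, hseq n < slidDist W A t ω :=
        (tendsto_one_div_add_atTop_nhds_zero_nat.eventually (gt_mem_nhds hpos))
      filter_upwards [h1] with n hn
      refine ⟨hω, ?_⟩
      rwa [abs_of_pos (by positivity : (0 : ℝ) < hseq n)]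
    have hlim := (tendsto_slope_starDeriv_translate hB hρ₀ hBρ).comp tendsto_one_div_add_one_nhdsWithin
    refine hlim.congr' ?_
    filter_upwards [hev] with n hn
    simp only [hF, Function.comp_apply, Set.indicator_of_mem hn]
    rfl
  · simp only [Set.indicator_of_notMem (show ω ∉ {ω | Disjoint (closedHull (W ω) t) A} from hω)]
    have hzero : ∀ n, F n ω = 0 := fun n ↦ by
      have hn : ω ∉ E n := fun h ↦ hω h.1
      simp only [hF, Set.indicator_of_notMem hn, sub_self, zero_div]
    simp_rw [hzero]
    exact tendsto_const_nhds

/-- **`ω ↦ E_{B_t}‴(0) · 𝟙{alive}` is measurable** (second difference quotients,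
`tendsto_secondDiff_starDeriv_translate`). [cite: LawlerSchrammWerner2003Restriction, §5 (h_t‴(W_t) in (5.3))] -/
theorem measurable_indicator_starJet3_slidHull (hc : ∀ ω, Continuous (W ω)) (hW0 : ∀ ω, W ω 0 = 0)
    (hmeas : ∀ s, s ≤ t → Measurable fun ω ↦ W ω s) (hA : IsStarHull A) (hne : A.Nonempty) :
    Measurable fun ω ↦ Set.indicator {ω | Disjoint (closedHull (W ω) t) A}
      (fun ω ↦ starJet3 (slidHull (W ω) A t)) ω := by
  classical
  set hseq : ℕ → ℝ := fun n ↦ 1 / ((n : ℝ) + 1) with hhseq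
  set E : ℕ → Set Ω := fun n ↦ {ω | Disjoint (closedHull (W ω) t) A ∧ |hseq n| < slidDist W A t ω} with hE
  set E' : ℕ → Set Ω := fun n ↦ {ω | Disjoint (closedHull (W ω) t) A ∧ |-hseq n| < slidDist W A t ω} with hE'
  set F : ℕ → Ω → ℝ := fun n ω ↦
    ((E n).indicator (fun ω ↦ starDeriv (translate (slidHull (W ω) A t) (hseq n))) ω -
      2 * (E n).indicator (fun ω ↦ starDeriv (slidHull (W ω) A t)) ω +
      (E' n).indicator (fun ω ↦ starDeriv (translate (slidHull (W ω) A t) (-hseq n))) ω) / hseq n ^ 2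
    with hF
  have hDm : Measurable fun ω ↦ Set.indicator {ω | Disjoint (closedHull (W ω) t) A}
      (fun ω ↦ starDeriv (slidHull (W ω) A t)) ω :=
    measurable_indicator_starDeriv_slidHull hc hW0 hmeas hA hne
  have hFm : ∀ n, Measurable (F n) := by
    intro n
    have h1 := measurable_indicator_starDeriv_translate_slidHull hc hW0 hmeas hA hne (hseq n)
    have h3 := measurable_indicator_starDeriv_translate_slidHull hc hW0 hmeas hA hne (-hseq n)
    have hEn : MeasurableSet (E n) := measurableSet_alive_and_lt_slidDist hc hW0 hmeas hA hne (hseq n)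
    have h2 : Measurable fun ω ↦ (E n).indicator (fun ω ↦ starDeriv (slidHull (W ω) A t)) ω := by
      have : (fun ω ↦ (E n).indicator (fun ω ↦ starDeriv (slidHull (W ω) A t)) ω) =
          fun ω ↦ (E n).indicator (fun ω ↦ Set.indicator {ω | Disjoint (closedHull (W ω) t) A}
            (fun ω ↦ starDeriv (slidHull (W ω) A t)) ω) ω := by
        funext ω
        by_cases hω : ω ∈ E n
        · rw [Set.indicator_of_mem hω, Set.indicator_of_mem hω,
            Set.indicator_of_mem (show ω ∈ {ω | Disjoint (closedHull (W ω) t) A} from hω.1)]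
        · rw [Set.indicator_of_notMem hω, Set.indicator_of_notMem hω]
      rw [this]
      exact hDm.indicator hEn
    exact ((h1.sub (h2.const_mul 2)).add h3).div_const _
  refine measurable_of_tendsto_metrizable hFm (tendsto_pi_nhds.2 fun ω ↦ ?_)
  by_cases hω : Disjoint (closedHull (W ω) t) A
  · simp only [Set.indicator_of_mem (show ω ∈ {ω | Disjoint (closedHull (W ω) t) A} from hω)]
    have hB := isStarHull_slidHull_of_disjoint (hc ω) hA hω
    obtain ⟨ρ₀, hρ₀, hBρ⟩ := exists_rho_of_isStarHull hB
    have hpos := slidDist_pos_of_disjoint (hc ω) hA hne hω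
    have hev : ∀ᶠ n in atTop, ω ∈ E n ∧ ω ∈ E' n := by
      have h1 : ∀ᶠ n in atTop, hseq n < slidDist W A t ω :=
        (tendsto_one_div_add_atTop_nhds_zero_nat.eventually (gt_mem_nhds hpos))
      filter_upwards [h1] with n hn
      have hp : (0 : ℝ) < hseq n := by positivity
      exact ⟨⟨hω, by rwa [abs_of_pos hp]⟩, ⟨hω, by rwa [abs_neg, abs_of_pos hp]⟩⟩
    have hlim := (tendsto_secondDiff_starDeriv_translate hB hρ₀ hBρ).comp tendsto_one_div_add_one_nhdsWithin
    refine hlim.congr' ?_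
    filter_upwards [hev] with n hn
    simp only [hF, Function.comp_apply, Set.indicator_of_mem hn.1, Set.indicator_of_mem hn.2]
    rfl
  · simp only [Set.indicator_of_notMem (show ω ∉ {ω | Disjoint (closedHull (W ω) t) A} from hω)]
    have hzero : ∀ n, F n ω = 0 := fun n ↦ by
      have hn : ω ∉ E n := fun h ↦ hω h.1
      have hn' : ω ∉ E' n := fun h ↦ hω h.1
      simp only [hF, Set.indicator_of_notMem hn, Set.indicator_of_notMem hn', mul_zero, sub_self, add_zero,
        zero_div]
    simp_rw [hzero]
    exact tendsto_const_nhds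

/-- **The Schwarzian mass `m(B_t) · 𝟙{alive}` of the slid hull is measurable in the driving path**
(`m = c₂²/(4d²) − c₃/(6d) = bubbleMass d (c₂/2) (c₃/6)` with `d = starDeriv`, `c₂ = starJet2`,
`c₃ = starJet3`; the integrand of the compensator `exp(−λ ∫ m)` of [LSW] Prop. 5.3).
[cite: LawlerSchrammWerner2003Restriction, Prop. 5.3 (the compensator ∫ Sh_s(W_s)/6 ds)] -/
theorem measurable_indicator_schwarzMass_slidHull (hc : ∀ ω, Continuous (W ω)) (hW0 : ∀ ω, W ω 0 = 0)
    (hmeas : ∀ s, s ≤ t → Measurable fun ω ↦ W ω s) (hA : IsStarHull A) (hne : A.Nonempty) :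
    Measurable fun ω ↦ Set.indicator {ω | Disjoint (closedHull (W ω) t) A}
      (fun ω ↦ bubbleMass (starDeriv (slidHull (W ω) A t)) (starJet2 (slidHull (W ω) A t) / 2)
        (starJet3 (slidHull (W ω) A t) / 6)) ω := by
  have hD := measurable_indicator_starDeriv_slidHull hc hW0 hmeas hA hne
  have h2 := measurable_indicator_starJet2_slidHull hc hW0 hmeas hA hne
  have h3 := measurable_indicator_starJet3_slidHull hc hW0 hmeas hA hne
  have hEm := measurableSet_disjoint_closedHull hc hW0 hmeas hA hne
  -- `𝟙_E · m(d, c₂, c₃) = m(𝟙_E d, 𝟙_E c₂, 𝟙_E c₃) · 𝟙_E` pointwise; we write the indicator as an `ite`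
  classical
  have heq : (fun ω ↦ Set.indicator {ω | Disjoint (closedHull (W ω) t) A}
      (fun ω ↦ bubbleMass (starDeriv (slidHull (W ω) A t)) (starJet2 (slidHull (W ω) A t) / 2)
        (starJet3 (slidHull (W ω) A t) / 6)) ω) =
      fun ω ↦ if ω ∈ {ω | Disjoint (closedHull (W ω) t) A} then
        bubbleMass (Set.indicator {ω | Disjoint (closedHull (W ω) t) A} (fun ω ↦ starDeriv (slidHull (W ω) A t)) ω)
          (Set.indicator {ω | Disjoint (closedHull (W ω) t) A} (fun ω ↦ starJet2 (slidHull (W ω) A t)) ω / 2)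
          (Set.indicator {ω | Disjoint (closedHull (W ω) t) A} (fun ω ↦ starJet3 (slidHull (W ω) A t)) ω / 6)
        else 0 := by
    funext ω
    by_cases hω : ω ∈ {ω | Disjoint (closedHull (W ω) t) A}
    · simp only [Set.indicator_of_mem hω, if_pos hω]
    · simp only [Set.indicator_of_notMem hω, if_neg hω]
  rw [heq]
  refine Measurable.ite hEm ?_ measurable_const
  unfold bubbleMass
  exact ((h2.div_const 2).pow_const 2 |>.div (hD.pow_const 2)).sub ((h3.div_const 6).div hD)

end Loewner

end Literature.Probability.RandomPlanarGeometry

end
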